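import Summits.Ventures.DiscreteObjects.PP12.FlagTenConjunctR1
import Summits.Ventures.DiscreteObjects.PP12.FlagTenConjunctR3
import Summits.Ventures.DiscreteObjects.PP12.FlagTenOrbitMatrix

/-!
# The `f = 10` flag-cell orbit data: equation (R2) at subtype level (kernel; Step D, conjunct 7 of `IsFlagTenOrbitMatrix` before transport)
Framing: lottery ticket; floor = certified bounds/negative ranges.

Cell pub-namedobj (venture DiscreteObjects), target (M), designs gen 14 (HOME designs-g13 FAMILY-FLAG7X §7c). Setting as in
`FlagTenOrbitDataOfPlane` (`σ³ = 1`, flag type, `f = 10`, order 12, `u₀ ∋ c` a non-fixed line; vertices = points `≠ c` of `u₀`).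
For a vertex `x`, the vertex `v` with `phiVertex v = x` (the triangle of `v` is inscribed in the triangle of `x`; `v = φ⁻¹ x`), a fixed
point `y ≠ c` and a T-line `b ∋ y`, `b ≠ l`:
`#{m fixed, m ≠ l : betaOrb m (orb3 b) = gammaOrb m x} + 2·[cOrb y x = orb3 b] + [cOrb y v = orb3 b] = 3` (**`side_tline_count`**),
i.e. conjunct 7 `#{j : β k j t = γ j i} + 2[C k i = t] + [C k (φ⁻¹ i) = t] = 3` before transport. It is the plane-level identity
`OrbitSideIdentities.side_tline_identity` (λ = 1 for the side `x·σx` against `b`), with the points of the side sorted into its Z-point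
(never counted: the orbit of `b ∩ l = y` is trivial), its T-points (counted iff `β = γ` on that fixed line), its own vertices
(`[cOrb y x = orb3 b]`, `FlagTenConjunctR3.cOrb_eq_iff`) and its odd point, which is THE point of the triangle of `v` on the side
(`odd_point_eq`, from `FlagTenConjunctR1.phiVertex_of_odd` and `phiVertex_injective`). No `sorry`, no new axioms.
-/

namespace Summit.Ventures.DiscreteObjects.PP12

open Configuration Finset
open scoped Classical

namespace Collineation

variable {P L : Type*} [Membership P L] [ProjectivePlane P L] [Fintype P] [Fintype L] (σ : Collineation P L)

omit [ProjectivePlane P L] [Fintype P] [Fintype L] in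
/-- Points of the orbit of a non-fixed point are not fixed. -/
theorem not_fixed_of_mem_orb3 {q q' : P} (hqf : σ.onPoints q ≠ q) (hq' : q' ∈ orb3 σ.onPoints q) : σ.onPoints q' ≠ q' := by
  rw [mem_orb3] at hq'
  rcases hq' with rfl | rfl | rfl
  · exact hqf
  · exact fun e => hqf (σ.onPoints.injective e)
  · exact fun e => hqf (σ.onPoints.injective (σ.onPoints.injective e))

section Flag

variable {l : L} {c : P} (hl : σ.onLines l = l) (hc : σ.onPoints c = c) (hcl : c ∈ l)
  (hP : ∀ p : P, σ.onPoints p = p → p ∈ l) (hL : ∀ m : L, σ.onLines m = m → c ∈ m)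
  (h12 : ProjectivePlane.order P L = 12)

include hl hc hcl hP hL h12 in
/-- **The odd point of a side** (`f = 10`): if `phiVertex v = x` for vertices `v, x`, then the triangle of `v` has a point `o` on the side
`x·σx`, `o` is exterior and not in the triangle of `x`, and EVERY exterior point of the side outside the triangle of `x` equals `o`. -/
theorem odd_point_eq (hq : σ.onPoints ^ 3 = 1) (hf : fixedCard σ.onPoints = 10) {u₀ : L} (hcu₀ : c ∈ u₀) (hu₀ : σ.onLines u₀ ≠ u₀)
    {x v : P} (hxu : x ∈ u₀) (hxc : x ≠ c) (hvu : v ∈ u₀) (hvc : v ≠ c) (hφv : σ.phiVertex l c u₀ v = x) :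
    ∃ o ∈ orb3 σ.onPoints v, o ∈ σ.sideOf l x ∧ (∀ m : L, σ.onLines m = m → o ∉ m) ∧ o ∉ orb3 σ.onPoints x ∧
      ∀ q : P, q ∈ σ.sideOf l x → (∀ m : L, σ.onLines m = m → q ∉ m) → q ∉ orb3 σ.onPoints x → q = o := by
  have hqL : σ.onLines ^ 3 = 1 := σ.onLines_pow_eq_one hq
  have hxX := σ.exterior_of_mem_cline hL hcu₀ hu₀ hxu hxc
  have hvX := σ.exterior_of_mem_cline hL hcu₀ hu₀ hvu hvc
  have hxf : σ.onPoints x ≠ x := σ.not_fixed_of_exterior_flag hl hP hxX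
  obtain ⟨hxa, hσxa⟩ := σ.sideOf_spec l hxf
  obtain ⟨hna, -⟩ := σ.side_no_fixed_point hxf hxX hxa hσxa
  -- v ≠ x: φ moves every triangle
  have hov : orb3 σ.onPoints x ≠ orb3 σ.onPoints v := by
    have := (σ.phiVertex_spec hl hc hcl hP hL h12 hq hf hcu₀ hu₀ hvX).2.2.2; rwa [hφv] at this
  have hvx : v ≠ x := fun e => hov (by rw [e])
  -- v lies on a side g of the triangle of x; transport along the orbit to the side x·σx itself
  obtain ⟨g, hg, hvg⟩ := (σ.phiVertex_eq_iff hl hc hcl hP hL h12 hq hf hcu₀ hu₀ hvu hvc hxu hxc hvx).1 hφv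
  obtain ⟨o, hov', hoa⟩ : ∃ o ∈ orb3 σ.onPoints v, o ∈ σ.sideOf l x := by
    have h3L := apply_three σ.onLines hqL (σ.sideOf l x)
    rw [mem_orb3] at hg
    rcases hg with e | e | e
    · exact ⟨v, self_mem_orb3 _ _, e ▸ hvg⟩
    · refine ⟨σ.onPoints (σ.onPoints v), (mem_orb3 _ _ _).2 (Or.inr (Or.inr rfl)), ?_⟩
      have := σ.mem_map (σ.mem_map hvg); rw [e, h3L] at this; exact this
    · refine ⟨σ.onPoints v, (mem_orb3 _ _ _).2 (Or.inr (Or.inl rfl)), ?_⟩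
      have := σ.mem_map hvg; rw [e, h3L] at this; exact this
  have hoX := σ.exterior_of_mem_orb3 hvX hov'
  have hox : o ∉ orb3 σ.onPoints x := by
    intro h'
    apply hvx
    apply σ.vertex_eq_of_mem_orb3 hc hq hcu₀ hu₀ hvu hxu
    rw [← orb3_eq_of_mem σ.onPoints hq h', orb3_eq_of_mem σ.onPoints hq hov']
    exact self_mem_orb3 _ _
  refine ⟨o, hov', hoa, hoX, hox, fun q hqa hqX hqx => ?_⟩
  -- the vertex of the triangle of q is v (φ injective), so q ∈ orb3 v; the side meets orb3 v only once
  obtain ⟨v', hv'q, hv'u⟩ := σ.exterior_orbit_meets_cline hl hc hcl hL h12 hq hf hcu₀ hu₀ hqX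
  obtain ⟨hv'c, hφ'⟩ := σ.phiVertex_of_odd hl hc hcl hP hL h12 hq hf hcu₀ hu₀ hxu hxc hqa hqX hqx hv'u hv'q
  have hvv' : v' = v := σ.phiVertex_injective hl hc hcl hP hL h12 hq hf hcu₀ hu₀ hv'u hv'c hvu hvc (hφ'.trans hφv.symm)
  have hqv : q ∈ orb3 σ.onPoints v := by
    rw [← hvv', orb3_eq_of_mem σ.onPoints hq hv'q]; exact self_mem_orb3 _ _
  by_contra hne
  have two : 2 ≤ ((orb3 σ.onPoints v).filter fun q' => q' ∈ σ.sideOf l x).card := by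
    have hsub : ({q, o} : Finset P) ⊆ (orb3 σ.onPoints v).filter fun q' => q' ∈ σ.sideOf l x := by
      intro z hz; rw [mem_insert, mem_singleton] at hz; rw [mem_filter]
      rcases hz with rfl | rfl
      · exact ⟨hqv, hqa⟩
      · exact ⟨hov', hoa⟩
    have := card_le_card hsub; rwa [card_pair hne] at this
  have twox : 2 ≤ ((orb3 σ.onPoints x).filter fun q' => q' ∈ σ.sideOf l x).card := by
    rw [σ.filter_orb3_eq_pair_of_side hxf hna hxa hσxa, card_pair (fun e => hxf e.symm)]
  have heq := σ.orb3_eq_of_two_le hq hna two twox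
  exact hvx (σ.vertex_eq_of_mem_orb3 hc hq hcu₀ hu₀ hvu hxu (by rw [← heq]; exact self_mem_orb3 _ _))

include hl hc hcl hP hL h12 in
/-- **(R2) at subtype level** (`f = 10`): see the module docstring. -/
theorem side_tline_count (hq : σ.onPoints ^ 3 = 1) (hf : fixedCard σ.onPoints = 10) {u₀ : L} (hcu₀ : c ∈ u₀) (hu₀ : σ.onLines u₀ ≠ u₀)
    {x v : P} (hxu : x ∈ u₀) (hxc : x ≠ c) (hvu : v ∈ u₀) (hvc : v ≠ c) (hφv : σ.phiVertex l c u₀ v = x)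
    {y : P} (hy : σ.onPoints y = y) (hyc : y ≠ c) {b : L} (hyb : y ∈ b) (hbl : b ≠ l) :
    (univ.filter fun m : L => σ.onLines m = m ∧ m ≠ l ∧ σ.betaOrb c m (orb3 σ.onLines b) = σ.gammaOrb l c m x).card
      + 2 * flagInd (σ.cOrb l y x = orb3 σ.onLines b) + flagInd (σ.cOrb l y v = orb3 σ.onLines b) = 3 := by
  have hxX := σ.exterior_of_mem_cline hL hcu₀ hu₀ hxu hxc
  have hvX := σ.exterior_of_mem_cline hL hcu₀ hu₀ hvu hvc
  have hxf : σ.onPoints x ≠ x := σ.not_fixed_of_exterior_flag hl hP hxX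
  obtain ⟨hxa, hσxa⟩ := σ.sideOf_spec l hxf
  obtain ⟨hna, ha0⟩ := σ.side_no_fixed_point hxf hxX hxa hσxa
  have hb : σ.onLines b ≠ b := σ.tline_not_fixed hcl hP hL hy hyc hyb hbl
  have hcb : c ∉ b := σ.c_not_mem_tline hcl hP hy hyc hyb hbl
  -- (R2) at plane level for the side x·σx against b
  have hid := σ.side_tline_identity hq hxf hna hxa hσxa (fun q hqa hqf => ha0 q hqf hqa) hb hy hyb
  -- the own-triangle term
  have hT1 : ((orb3 σ.onPoints x).filter fun q' => q' ∈ b).card = flagInd (σ.cOrb l y x = orb3 σ.onLines b) := by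
    have hle := σ.tline_orbit_simple hcl hP hL hq hy hyc hyb hbl x
    unfold flagInd
    by_cases hC : σ.cOrb l y x = orb3 σ.onLines b
    · rw [if_pos hC]
      obtain ⟨Q, hQ, hQb⟩ := (σ.cOrb_eq_iff hl hP hq hxX hy hyb).1 hC
      have hpos : 0 < ((orb3 σ.onPoints x).filter fun q' => q' ∈ b).card := card_pos.2 ⟨Q, mem_filter.2 ⟨hQ, hQb⟩⟩
      omega
    · rw [if_neg hC, card_eq_zero, filter_eq_empty_iff]
      intro Q hQ hQb
      exact hC ((σ.cOrb_eq_iff hl hP hq hxX hy hyb).2 ⟨Q, hQ, hQb⟩)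
  rw [hT1] at hid
  -- the odd point of the side
  obtain ⟨o, hov', hoa, hoX, hox, odd_mem⟩ := σ.odd_point_eq hl hc hcl hP hL h12 hq hf hcu₀ hu₀ hxu hxc hvu hvc hφv
  -- exterior orbits avoid the fixed lines
  have notin_ext : ∀ {p : P} {k : L}, σ.onLines k = k → p ∈ k → ∀ {E : P}, (∀ m' : L, σ.onLines m' = m' → E ∉ m') →
      p ∉ orb3 σ.onPoints E := by
    intro p k hk hpk E hEX hp
    exact (σ.exterior_of_mem_orb3 hEX hp) k hk hpk
  set N : Finset L := univ.filter fun m : L => σ.onLines m = m ∧ m ≠ l ∧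
      σ.betaOrb c m (orb3 σ.onLines b) = σ.gammaOrb l c m x with hN
  set R : Finset P := univ.filter fun q : P => q ∈ σ.sideOf l x ∧ q ∉ orb3 σ.onPoints x ∧
      ∃ q' ∈ orb3 σ.onPoints q, q' ∈ b with hR_def
  have hRdesc : R = (N.image fun m => meetPt c (σ.sideOf l x) m) ∪
      (if ∃ Q ∈ orb3 σ.onPoints v, Q ∈ b then {o} else ∅) := by
    ext q
    rw [hR_def, mem_filter, mem_union, mem_image]
    constructor
    · rintro ⟨-, hqa, hqx, q', hq', hq'b⟩
      by_cases hfix : ∃ m : L, σ.onLines m = m ∧ q ∈ m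
      · left
        obtain ⟨m, hm, hqm⟩ := hfix
        have hq'm : q' ∈ m := σ.mem_fixedLine_of_mem_orb3 hm hqm hq'
        have hqf : σ.onPoints q ≠ q := fun e => ha0 q e hqa
        have hq'f : σ.onPoints q' ≠ q' := σ.not_fixed_of_mem_orb3 hqf hq'
        -- m ≠ l: the only point of b on l is the fixed point y
        have hml : m ≠ l := by
          intro e
          rw [e] at hq'm
          have hq'y : q' = y := σ.tline_inter_l hP hy hyb hbl hq'b hq'm
          exact hq'f (by rw [hq'y, hy])
        have ham : σ.sideOf l x ≠ m := fun e => ha0 c hc (e ▸ hL m hm)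
        have hbm : b ≠ m := fun e => hcb (e ▸ hL m hm)
        refine ⟨m, ?_, (meetPt_eq c ham hqa hqm).symm⟩
        rw [hN, mem_filter]
        refine ⟨mem_univ _, hm, hml, ?_⟩
        rw [σ.betaOrb_eq hc hL hq hm hcb (self_mem_orb3 _ _)]
        change orb3 σ.onPoints (meetPt c b m) = orb3 σ.onPoints (meetPt c (σ.sideOf l x) m)
        rw [← meetPt_eq c hbm hq'b hq'm, ← meetPt_eq c ham hqa hqm]
        exact orb3_eq_of_mem σ.onPoints hq hq'
      · right
        push Not at hfix
        have hqX : ∀ m : L, σ.onLines m = m → q ∉ m := fun m hm hqm => hfix m hm hqm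
        have hqo : q = o := odd_mem q hqa hqX hqx
        have hex : ∃ Q ∈ orb3 σ.onPoints v, Q ∈ b := by
          refine ⟨q', ?_, hq'b⟩
          rw [← orb3_eq_of_mem σ.onPoints hq hov', ← hqo]
          exact hq'
        rw [if_pos hex, mem_singleton]
        exact hqo
    · rintro (⟨m, hmN, hq0⟩ | hq0)
      · rw [hN, mem_filter] at hmN
        obtain ⟨-, hm, -, hβ⟩ := hmN
        have ham : σ.sideOf l x ≠ m := fun e => ha0 c hc (e ▸ hL m hm)
        have hbm : b ≠ m := fun e => hcb (e ▸ hL m hm)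
        obtain ⟨hwa, hwm⟩ := meetPt_spec c ham
        obtain ⟨hw'b, -⟩ := meetPt_spec c hbm
        rw [← hq0]
        refine ⟨mem_univ _, hwa, notin_ext hm hwm hxX, meetPt c b m, ?_, hw'b⟩
        rw [σ.betaOrb_eq hc hL hq hm hcb (self_mem_orb3 _ _)] at hβ
        change orb3 σ.onPoints (meetPt c b m) = orb3 σ.onPoints (meetPt c (σ.sideOf l x) m) at hβ
        rw [← hβ]; exact self_mem_orb3 _ _
      · by_cases hex : ∃ Q ∈ orb3 σ.onPoints v, Q ∈ b
        · rw [if_pos hex, mem_singleton] at hq0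
          rw [hq0]
          obtain ⟨Q, hQ, hQb⟩ := hex
          refine ⟨mem_univ _, hoa, hox, Q, ?_, hQb⟩
          rw [orb3_eq_of_mem σ.onPoints hq hov']; exact hQ
        · rw [if_neg hex] at hq0
          exact absurd hq0 (Finset.notMem_empty _)
  -- counting
  have hinj : Set.InjOn (fun m => meetPt c (σ.sideOf l x) m) ↑N := by
    intro m₁ hm₁ m₂ hm₂ hk
    rw [mem_coe, hN, mem_filter] at hm₁ hm₂
    obtain ⟨-, hm₁f, -, -⟩ := hm₁
    obtain ⟨-, hm₂f, -, -⟩ := hm₂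
    have ham₁ : σ.sideOf l x ≠ m₁ := fun e => ha0 c hc (e ▸ hL m₁ hm₁f)
    have ham₂ : σ.sideOf l x ≠ m₂ := fun e => ha0 c hc (e ▸ hL m₂ hm₂f)
    obtain ⟨hw₁a, hw₁m⟩ := meetPt_spec c ham₁
    obtain ⟨-, hw₂m⟩ := meetPt_spec c ham₂
    have hk' : meetPt c (σ.sideOf l x) m₁ = meetPt c (σ.sideOf l x) m₂ := hk
    rw [← hk'] at hw₂m
    have hwc : meetPt c (σ.sideOf l x) m₁ ≠ c := fun e => ha0 c hc (e ▸ hw₁a)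
    by_contra hne
    exact hwc ((Nondegenerate.eq_or_eq hw₁m (hL m₁ hm₁f) hw₂m (hL m₂ hm₂f)).resolve_right hne)
  have hdisj : Disjoint (N.image fun m => meetPt c (σ.sideOf l x) m)
      (if ∃ Q ∈ orb3 σ.onPoints v, Q ∈ b then {o} else ∅) := by
    by_cases hex : ∃ Q ∈ orb3 σ.onPoints v, Q ∈ b
    · rw [if_pos hex, disjoint_singleton_right, mem_image]
      rintro ⟨m, hmN, hk⟩
      rw [hN, mem_filter] at hmN
      obtain ⟨-, hm, -, -⟩ := hmN
      have ham : σ.sideOf l x ≠ m := fun e => ha0 c hc (e ▸ hL m hm)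
      obtain ⟨-, hwm⟩ := meetPt_spec c ham
      rw [hk] at hwm
      exact hoX m hm hwm
    · rw [if_neg hex]; exact disjoint_empty_right _
  have hRcard : R.card = N.card + flagInd (σ.cOrb l y v = orb3 σ.onLines b) := by
    rw [hRdesc, card_union_of_disjoint hdisj, card_image_of_injOn hinj]
    congr 1
    unfold flagInd
    by_cases hex : ∃ Q ∈ orb3 σ.onPoints v, Q ∈ b
    · rw [if_pos hex, card_singleton, if_pos ((σ.cOrb_eq_iff hl hP hq hvX hy hyb).2 hex)]
    · rw [if_neg hex, card_empty, if_neg (fun h => hex ((σ.cOrb_eq_iff hl hP hq hvX hy hyb).1 h))]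
  rw [hRcard] at hid
  omega

end Flag

end Collineation

end Summit.Ventures.DiscreteObjects.PP12
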